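import Summits.BirchSwinnertonDyer.Rank1Residual.ManinAdditive.HurwitzBrandtTwoEisenstein
import Summits.BirchSwinnertonDyer.Rank1Residual.ManinAdditive.ALTateCohomology
import HarnessLib
import HarnessLib.Audit.Tags

/-!
# THE SUPERSINGULAR CM STRUCTURE OF THE ATKIN–LEHNER FIXED LOCUS IN CHARACTERISTIC 2 AT PRIME LEVEL — the stabiliser law
# (E-desc-89), the RAM GLUING THEOREM (E-desc-90 = E-desc-87 made a theorem on paper) and THEOREM I (INERT, E-desc-86) typed as
# decidable shadows + existential Cayley models over the tree's Hurwitz–Brandt vocabulary (desc g14, MEMO-desc §31; cell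
# `bsd-f2-manin`, T-desc-18, typer g15)

TYPER PROVENANCE.  SOURCE = HOME/desc/g14/Sketch-desc-g14.lean sha16 ed6e7e58aa774d13 (237 l.; farm rc 0 · 0 warnings · 0 sorries,
re-checked by the typer, 57 s incl. the six `decide +kernel` certificates), landed VERBATIM (desc's header below is kept as written; only
this paragraph is added).  The Gauss three-squares count `r₃^prim` behind the class-number clauses (`h(−4p)/2`, `h(−p)`; REF1 §R96 (Q4))
is vendored separately as the Literature fact `Literature.NumberTheory.QuadraticFields.ThreeSquares.Gauss_threeSquaresPrim_classNumber`
(`Literature/NumberTheory/QuadraticFields/GaussThreeSquaresClassNumber.lean`, typer p676669, Voight Thm 30.1.3 / Gauss Art. 291); the rows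
here use desc's computable `reducedFormCount` of `ALTateCohomology.lean` for `h`.  One mechanical edit: desc's cite key `GrossZagier1985`
is spelled as the bib's `GrossZagier1985SingularModuli` (Gross–Zagier, *On singular moduli*, J. reine angew. Math. 355 (1985)).  REFUTER VERDICTS: REF1 §R96 (set-level content of
E-86/87/89 KNOWN in substance — Gauss/Venkov/Ogg/Gross named by desc above; Tate-module/Hecke part = desc's); R-desc-19 (referee of
MEMO-desc §31.1–31.2) PENDING at filing.  bears_on: stmt-BirchSwinnertonDyer-22967.

HONEST FRAMING.  LENS = descent / visibility (`bsd-f2-manin-desc` g14).  Everything here is E-BLIND and lives at PRIME level `p`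
(the tree's `HurwitzBrandt` model `A₄ \ ℙ¹(𝔽_p)` = supersingular points `SS_p` of `X₀(p)` over `𝔽̄₂`, `brandtTable` = `T_r`).
New computable vocabulary (no `sorry`, no instances, no notation): `pureOfNorm r` (trace-zero Hurwitz = Lipschitz pure quaternions
of norm `r`), `killsWith` (a singular quaternion annihilates the line `x` mod `p`), `stabOrder p x = #Stab_{A₄}(x)`,
`alFixedReps p` = the `w_p`-FIXED supersingular classes (LEMMA 2 of MEMO §31.1: `[x]` is `w_p`-fixed iff some trace-zero `γ ∈ O`
of norm `p` has `ker γ = x`, `p ≥ 5`), `frobRep p` = geometric Frobenius `F` (the norm-2 element `1 + i`), `brandtCount p r x y`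
= multiplicity of `[y]` in `T_r[x]`.
STATEMENTS (all `@[conjecture]` = statement-only cell rows; E-89/E-90/THEOREM I are THEOREMS ON PAPER in MEMO-desc §31.1–31.2
modulo three cited standard facts [DL] Deuring–Gross–Zagier lifting for orders of conductor prime to 2, [ES] Hecke/reduction
compatibility, [CM] `Fix(w_Q)(ℚ̄)` = Heegner torsor of `ℤ[√−Q]` (⊔ `O_{−Q}` if `Q ≡ 3 (4)`); referee audit R-desc-19 requested):
* `HurwitzStabiliserLaw` (E-desc-89): stabilisers in `A₄` are cyclic of order 1, 2, 3; exactly `[p ≡ 1 (4)]` class of stabiliser 2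
  and `2·[p ≡ 1 (3)]` of stabiliser 3; no `w_p`-fixed class has stabiliser 3; the stabiliser-2 class is `w_p`-fixed.
* `ALSupersingularGluingShadow p r` / `ALSupersingularGluingLaw` (E-desc-90, `p ≡ 1 (4)`): `#SS_p^{w_p} = h(−4p)/2`,
  `#Fix(F) = 1 + [p ≡ 1 (8)]`, the row of the stabiliser-2 point `s_*` in `T_r mod 2` restricted to fixed classes VANISHES and the
  fixed–fixed block is symmetric off `s_*` (decidable), and the CAYLEY MODEL M3: `SS_p^{w_p} ≅ (Cl(−4p) ∖ Cl[2])/± ⊔ {s_*}` with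
  `T̂_r = σ_𝔩 + σ_𝔩⁻¹` pushed forward and `F = ·[𝔭₂]` (existential over an abstract finite commutative group of order `h(−4p)`).
* `ALSupersingularInertCayleyLaw` (THEOREM I shadow, `p ≡ 3 (8)`, `p ≥ 11`): `SS_p^{w_p} ≅ Cl(−p)` with `T̂_r = σ_𝔩 + σ_𝔩⁻¹`,
  `F` = inversion (one fixed point), all stabilisers trivial.
BC5 WITNESS: PRE-REGISTERED run PREREG-G14 (HOME/desc/g14/PREREG-g14.txt 78f1c752007d2dd3, registered BEFORE any run at 74 fresh
prime-power levels 311 ≤ Q ≤ 7921): G1 stabiliser law 74/74, RAM-A M3 isomorphism 32/32 (+ alternative M2 rejected 31/31), RAM-B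
M2 15/15, INERT 19/19, ORD 8/8, G0 66/66; retrodiction on the g13 census (490 Brandt lines): stabiliser-2 fixed points only at
`N = Q` 35/35, stabiliser-3 fixed points only at `Q = 3` 13/13; plus the kernel certificates of §4 below (`p = 29, 41, 59`).
CHEAPEST FALSIFIER: one prime `p ≡ 1 (4)` with `2·#alFixedReps p ≠ h(−4p)` or an odd `T_r`-entry in the row of `s_*` (0/47 RAM-A
prime-power levels to date).  WHY NOVEL (MEMO §31.6, corpus fts+vec + galaxy): Gross 1987 / Bertolini–Darmon put `Cl(O_K)` on
supersingular points in characteristic = the LEVEL prime via `B_{p,∞}`; no source describes the `w_Q`-fixed supersingular locus of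
`X₀(Q)` in characteristic 2 (Hurwitz order) as the inertia quotient of the Heegner torsor with the two inertia-fixed classes glued at
the unique `#Aut = 4` point, nor the criterion `p ≡ 1 (mod 4)`.
PARTITION 0 · beyond-print theorem: yes-on-paper (MEMO §31.1–31.2, pending R-desc-19) · BSD is not proved by this; Manin's
conjecture is not proved by this.
[cite: GrossZagier1985SingularModuli, Prop. 2.7 (shape [DL]); Gross1987Heights, §3 (the CM/supersingular dictionary at the level prime — the
characteristic-2 Atkin–Lehner version is the cell's, NOT in print)]
-/

set_option autoImplicit false

namespace Summit.BirchSwinnertonDyer.Rank1Residual.ManinAdditive.ALSupersingularCM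

open Summit.BirchSwinnertonDyer.Rank1Residual.ManinAdditive.HurwitzBrandt
open Summit.BirchSwinnertonDyer.Rank1Residual.ManinAdditive.ALTateCohomology

/-! ### §1. Computable vocabulary on top of `HurwitzBrandt` -/

/-- the trace-zero Hurwitz quaternions of reduced norm `r` in doubled coordinates `(0, 2x, 2y, 2z)`, `x² + y² + z² = r`
(= the Lipschitz pure quaternions `xi + yj + zk`; empty iff `r` is not a sum of three squares, e.g. `r ≡ 7 (mod 8)`). [folklore] -/
def pureOfNorm (r : ℕ) : List DQuat :=
  let m : ℕ := Nat.sqrt r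
  let cs : List ℤ := (List.range (2 * m + 1)).map (fun t => (t : ℤ) - m)
  (cs.flatMap fun x => cs.flatMap fun y => cs.map fun z => ((0, 2 * x, 2 * y, 2 * z) : DQuat)).filter
    (fun q => q.dnorm == 4 * (r : ℤ))

/-- the vector `M(q)·v_x ∈ ℕ²` (same matrix and same vector convention as `HurwitzBrandt.actWith`, before `toPoint`). [folklore] -/
def applyVecWith (p a b : ℕ) (q : DQuat) (x : Fin (p + 1)) : ℕ × ℕ :=
  let a0 : ℕ := (q.1 % (p : ℤ)).toNat
  let a1 : ℕ := (q.2.1 % (p : ℤ)).toNat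
  let a2 : ℕ := (q.2.2.1 % (p : ℤ)).toNat
  let a3 : ℕ := (q.2.2.2 % (p : ℤ)).toNat
  let na : ℕ := p - a % p
  let nb : ℕ := p - b % p
  let m11 : ℕ := a0 + a1 * a + a3 * nb
  let m12 : ℕ := a1 * b + a2 + a3 * a
  let m21 : ℕ := a1 * b + (p - a2 % p) + a3 * a
  let m22 : ℕ := a0 + a1 * na + a3 * b
  let v1 : ℕ := if (x : ℕ) < p then (x : ℕ) else 1
  let v2 : ℕ := if (x : ℕ) < p then 1 else 0
  (m11 * v1 + m12 * v2, m21 * v1 + m22 * v2)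

/-- `q` ANNIHILATES the line `x ⊂ E₀[p]`: `M(q)·v_x ≡ 0 (mod p)` (meaningful for `q` of norm divisible by `p`). [folklore] -/
def killsWith (p a b : ℕ) (q : DQuat) (x : Fin (p + 1)) : Bool :=
  ((applyVecWith p a b q x).1 % p == 0) && ((applyVecWith p a b q x).2 % p == 0)

/-- the order of the stabiliser of `x ∈ ℙ¹(𝔽_p)` in `A₄ = O^×/±1` (`= #Aut(E₀, C_x)/2`): half the number of the 24 units
fixing `x`. [folklore] -/
def stabOrderWith (p a b : ℕ) (x : Fin (p + 1)) : ℕ :=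
  (hurwitzUnits.filter fun u => actWith p a b u x == x).length / 2

/-- `stabOrderWith` with the file's embedding `negOneAsSumOfTwoSquares p`. [folklore] -/
def stabOrder (p : ℕ) (x : Fin (p + 1)) : ℕ :=
  stabOrderWith p (negOneAsSumOfTwoSquares p).1 (negOneAsSumOfTwoSquares p).2 x

/-- `x` is `w_p`-FIXED: some trace-zero Hurwitz quaternion `γ` of norm `p` (so `γ² = −p`) has `ker γ = x` on `E₀[p]`; then
`γ(E₀[p]) = ker γ` automatically and `(E₀, C_x) ≅ (E₀/C_x, E₀[p]/C_x) = w_p(E₀, C_x)`.  For `p ≥ 5` this is exactly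
`[x] ∈ SS_p^{w_p}` (LEMMA 2 of MEMO-desc §31.1: every `γ` in the Atkin–Lehner set of a fixed point has `γ² = −Q`). [folklore] -/
def alFixedWith (p a b : ℕ) (x : Fin (p + 1)) : Bool :=
  (pureOfNorm p).any fun γ => killsWith p a b γ x

/-- the `w_p`-fixed supersingular classes `SS_p^{w_p}`, by least representatives (a sublist of `classReps p`). [folklore] -/
def alFixedReps (p : ℕ) : List (Fin (p + 1)) :=
  (classReps p).filter fun x => alFixedWith p (negOneAsSumOfTwoSquares p).1 (negOneAsSumOfTwoSquares p).2 x

/-- geometric FROBENIUS `F[C] = [π(C)]` on `SS_p`, `π = 1 + i` (doubled `(2,2,0,0)`, norm 2), as a map on representatives. [folklore] -/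
def frobRep (p : ℕ) (x : Fin (p + 1)) : Fin (p + 1) :=
  classRep p (act p ((2, 2, 0, 0) : DQuat) x)

/-- the multiplicity of the class `[y]` in `T_r[x]`: `#{α ∈ O : Nrd α = r, [α·x] = [y]}/24` (= the `(x, y)` entry of
`brandtTable p r` when `x, y ∈ classReps p`). [folklore] -/
def brandtCount (p r : ℕ) (x y : Fin (p + 1)) : ℕ :=
  ((hurwitzOfNorm r).filter fun α => classRep p (act p α x) == y).length / 24

/-! ### §2. E-desc-89 — the STABILISER LAW (THEOREM on paper, MEMO-desc §31.1 LEMMAS 1–3) -/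

/-- **E-desc-89 `HurwitzStabiliserLaw`.**  For every prime `p ≥ 5`: (i) every stabiliser `Stab_{A₄}(x)` has order 1, 2 or 3
(`Q₈ ↪ Borel(𝔽_p)` is impossible); (ii) exactly `[p ≡ 1 (mod 4)]` class has stabiliser of order 2 (the `u`-eigenlines, `u² = −1`)
and exactly `2·[p ≡ 1 (mod 3)]` classes have stabiliser of order 3; (iii) NO `w_p`-fixed class has stabiliser 3 (an element of odd
norm cannot invert `ω`: `(−3, b)_2 = (−1)^{v₂(b)}`); (iv) the stabiliser-2 class is `w_p`-fixed (`γ = aj + bk`, `a² + b² = p`).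
Census: PREREG-G14 G1 74/74 fresh prime-power levels + g13 retrodiction 490/490 Brandt lines.  Why it might fail: only through a
slip in LEMMA 2 (the proof is elementary); as typed it is decidable prime by prime.
[conjecture — cell row E-desc-89; THEOREM on paper MEMO-desc §31.1, not a tree fact]
[cite: Gross1987Heights, §1 (shape: `SS_p = O^× \ ℙ¹`; the statement is the cell's)] -/
@[conjecture]
def HurwitzStabiliserLaw : Prop :=
  ∀ p : ℕ, p.Prime → 5 ≤ p →
    (∀ x ∈ classReps p, stabOrder p x = 1 ∨ stabOrder p x = 2 ∨ stabOrder p x = 3) ∧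
    (classReps p).countP (fun x => stabOrder p x == 2) = (if p % 4 = 1 then 1 else 0) ∧
    (classReps p).countP (fun x => stabOrder p x == 3) = (if p % 3 = 1 then 2 else 0) ∧
    (∀ x ∈ alFixedReps p, stabOrder p x ≠ 3) ∧
    (∀ x ∈ classReps p, stabOrder p x = 2 → x ∈ alFixedReps p)

/-! ### §3. E-desc-90 — the RAM GLUING THEOREM at prime level `p ≡ 1 (mod 4)` and THEOREM I (INERT, `p ≡ 3 (mod 8)`) -/

/-- **Decidable shadow of the gluing theorem at `(p, r)`** (`p ≡ 1 (mod 4)` prime, `r` an odd prime `≠ p`): (a) `2·#SS_p^{w_p} =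
h(−4p)`; (b) `#Fix(F | SS_p^{w_p}) = #(Cl[2] ∩ Cl²) = 1 + [p ≡ 1 (mod 8)]`; (c) there is a `w_p`-fixed class `s_*` of stabiliser 2,
fixed by `F`, whose ROW in `T_r mod 2` restricted to the fixed classes vanishes (`T̂_r(s_*) = 0`: the two Heegner neighbours
`x_𝔩, x_{𝔩⁻¹}` of an inertia-fixed point reduce to the SAME point); (d) the fixed–fixed block of `T_r mod 2` is symmetric off `s_*`. -/
def ALSupersingularGluingShadow (p r : ℕ) : Prop :=
  2 * (alFixedReps p).length = reducedFormCount (-4 * (p : ℤ)) ∧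
  (alFixedReps p).countP (fun x => frobRep p x == x) = (if p % 8 = 1 then 2 else 1) ∧
  (∃ s ∈ alFixedReps p, stabOrder p s = 2 ∧ frobRep p s = s ∧
    (∀ y ∈ alFixedReps p, brandtCount p r s y % 2 = 0) ∧
    (∀ x ∈ alFixedReps p, ∀ y ∈ alFixedReps p, x ≠ s → y ≠ s → brandtCount p r x y % 2 = brandtCount p r y x % 2))

/-- **E-desc-90 `ALSupersingularGluingLaw` (the RAM GLUING THEOREM, prime level; THEOREM on paper MEMO-desc §31.1).**  For every
prime `p ≡ 1 (mod 4)` and every odd prime `r ≠ p`: the shadow (a)–(d), AND the Cayley model M3 — there are a finite commutative group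
`G` (in truth `Cl(ℤ[√−p])`, `#G = h(−4p)`), an element `t ≠ 1 = t²` generating `G[2]` (in truth `[𝔭₂]`), and a class map
`cls : G → ℙ¹(𝔽_p)` onto `SS_p^{w_p}` whose fibres are `{g, g⁻¹}` for `g ∉ G[2]` and `G[2] = {1, t}` (GLUED at the stabiliser-2
point), such that `F ∘ cls = cls ∘ (·t)` and, for some `l ∈ G` present iff `r` splits in `ℚ(√−p)` (in truth `[𝔩]`),
`T_r[cls g] ∋ [y]` with ODD multiplicity iff exactly one of `cls (g·l) = y`, `cls (g·l⁻¹) = y` holds (all multiplicities even when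
`r` is inert).  MECHANISM (proof on paper): reduction of the Heegner torsor of `ℤ[√−p]` modulo a prime over 2 is 2 : 1 onto
`SS_p^{w_p}` with fibres the inertia orbits, inertia = a reflection `ρ` conjugate to complex conjugation iff `p ≡ 1 (mod 4)` (genus
field `ℚ(i, √p)`), `Fix(ρ) = Cl[2]·x₁` = the fibre of the unique `#Aut = 4` point (two anticommuting `γ`'s there).  Census /
BC5: PREREG-G14 RAM-A 32/32 fresh levels (M3 incl. `F` and `* = s_*`; alternative M2 rejected 31/31) + g13 27/28 (+81 = M2 branch);
kernel: `ALSupersingularGluingShadow 29 3`, `41 3` below.  Why it might fail: as typed only through [DL]/[ES]/[CM] being misquoted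
(R-desc-19); numerically 0/47 RAM-A levels fail.
[conjecture — cell row E-desc-90 (supersedes E-desc-87 at prime level); THEOREM on paper, not a tree fact]
[cite: GrossZagier1985SingularModuli, Prop. 2.7 (shape [DL]); Gross1987Heights, §3 (shape)] -/
@[conjecture]
def ALSupersingularGluingLaw : Prop :=
  ∀ p : ℕ, p.Prime → p % 4 = 1 → ∀ r : ℕ, r.Prime → r % 2 = 1 → r ≠ p →
    ALSupersingularGluingShadow p r ∧
    ∃ (G : Type) (_ : CommGroup G) (_ : Fintype G) (t : G) (cls : G → Fin (p + 1)),
      Fintype.card G = reducedFormCount (-4 * (p : ℤ)) ∧ t ≠ 1 ∧ t * t = 1 ∧ (∀ u : G, u * u = 1 → u = 1 ∨ u = t) ∧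
      (∀ g : G, cls g ∈ alFixedReps p) ∧ (∀ x ∈ alFixedReps p, ∃ g : G, cls g = x) ∧
      (∀ g g' : G, cls g = cls g' ↔ (g' = g ∨ g' = g⁻¹ ∨ (g * g = 1 ∧ g' * g' = 1))) ∧
      stabOrder p (cls 1) = 2 ∧
      (∀ g : G, frobRep p (cls g) = cls (g * t)) ∧
      ∃ l : Option G, (l.isSome = true ↔ jacobiSym (-(p : ℤ)) r = 1) ∧
        ∀ g : G, ∀ y ∈ alFixedReps p,
          (brandtCount p r (cls g) y % 2 = 1 ↔
            ∃ l₀ : G, l = some l₀ ∧ Xor (cls (g * l₀) = y) (cls (g * l₀⁻¹) = y))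

/-- **THEOREM I shadow `ALSupersingularInertCayleyLaw` (E-desc-86 at prime level; THEOREM on paper MEMO-desc §31.2).**  For every
prime `p ≡ 3 (mod 8)`, `p ≥ 11`, and every odd prime `r ≠ p`: all `w_p`-fixed classes have trivial stabiliser, `#SS_p^{w_p} = h(−p)`,
and there are a finite commutative group `G` (in truth `Cl(O_{−p})`, odd order) and a BIJECTION `e : SS_p^{w_p} → G` with
`e ∘ F = (·)⁻¹ ∘ e` (so `F` has exactly one fixed point) and `T_r[x] ∋ [y]` with odd multiplicity iff exactly one of
`e y = e x · l`, `e y = e x · l⁻¹` (`l` present iff `r` splits in `ℚ(√−p)`; all even when inert).  MECHANISM: 2 is inert in `K`,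
unramified in the ring class field, the normalisation separates `φ` from `φ̄`, so reduction is a bijection of the Heegner torsor of
`O_{−p}` onto `SS_p^{w_p}` (one `±γ` per Eichler order — RIGIDITY), `F` = the Frobenius reflection (one fixed point since `h` odd),
`T̂_r` from the free `w_p`-orbits of conductor-`r` points.  Census: g13 16/16 simultaneous bijections + 268/268 charpolys, PREREG-G14
INERT 19/19 fresh levels (incl. `3³, 3⁷, 11³, 19³`); kernel: `p = 59` below.  Why it might fail: as E-90.
[conjecture — cell row E-desc-86′ (prime level); THEOREM on paper, not a tree fact]
[cite: GrossZagier1985SingularModuli, Prop. 2.7 (shape [DL]); Gross1987Heights, §3 (shape)] -/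
@[conjecture]
def ALSupersingularInertCayleyLaw : Prop :=
  ∀ p : ℕ, p.Prime → p % 8 = 3 → 11 ≤ p → ∀ r : ℕ, r.Prime → r % 2 = 1 → r ≠ p →
    (∀ x ∈ alFixedReps p, stabOrder p x = 1) ∧
    (alFixedReps p).length = reducedFormCount (-(p : ℤ)) ∧
    (alFixedReps p).countP (fun x => frobRep p x == x) = 1 ∧
    ∃ (G : Type) (_ : CommGroup G) (_ : Fintype G) (e : Fin (p + 1) → G),
      Fintype.card G = reducedFormCount (-(p : ℤ)) ∧
      (∀ x ∈ alFixedReps p, ∀ y ∈ alFixedReps p, e x = e y → x = y) ∧ (∀ g : G, ∃ x ∈ alFixedReps p, e x = g) ∧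
      (∀ x ∈ alFixedReps p, e (frobRep p x) = (e x)⁻¹) ∧
      ∃ l : Option G, (l.isSome = true ↔ jacobiSym (-(p : ℤ)) r = 1) ∧
        ∀ x ∈ alFixedReps p, ∀ y ∈ alFixedReps p,
          (brandtCount p r x y % 2 = 1 ↔ ∃ l₀ : G, l = some l₀ ∧ Xor (e y = e x * l₀) (e y = e x * l₀⁻¹))

/-! ### §4. Kernel certificates (BC5, `decide +kernel`): `p = 13, 17, 29, 41` (RAM-A) and `p = 11, 59` (INERT) -/

/-- `p = 13`: classes `[0,2,3]` have stabilisers `[2,3,3]` (one stabiliser-2 class since `13 ≡ 1 (4)`, two stabiliser-3 classes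
since `13 ≡ 1 (3)`). [folklore] -/
theorem stabOrder_thirteen : (classReps 13).map (stabOrder 13) = [2, 3, 3] := by decide +kernel

/-- `p = 13`: the only `w_13`-fixed supersingular class is the stabiliser-2 class `0` (`h(−52) = 2`). [folklore] -/
theorem alFixedReps_thirteen : alFixedReps 13 = [0] := by decide +kernel

/-- `p = 17`: stabilisers `[2, 1]`, both classes `w_17`-fixed (`h(−68) = 4`), both `F`-fixed (`17 ≡ 1 (8)`). [folklore] -/
theorem alFixedReps_seventeen :
    (classReps 17).map (stabOrder 17) = [2, 1] ∧ alFixedReps 17 = [0, 2] ∧ (alFixedReps 17).map (frobRep 17) = [0, 2] := by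
  decide +kernel

/-- `p = 29`: `SS^{w} = [0,2,3]` (`h(−116) = 6`), stabilisers `[2,1,1]`, `F` fixes only `s_* = 0` (`29 ≡ 5 (8)`). [folklore] -/
theorem alFixedReps_twentyNine :
    alFixedReps 29 = [0, 2, 3] ∧ (alFixedReps 29).map (stabOrder 29) = [2, 1, 1] ∧
      (alFixedReps 29).map (frobRep 29) = [0, 3, 2] := by
  decide +kernel

/-- `p = 29`, `r = 3`: the fixed–fixed block of `T₃` is `[[0,2,2],[1,0,3],[1,3,0]]` — row of `s_*` even, symmetric off `s_*`,
column of `s_*` odd (the Brandt asymmetry of MEMO §30.13 (II) explained). [folklore] -/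
theorem brandtCount_twentyNine_three :
    (alFixedReps 29).map (fun x => (alFixedReps 29).map (brandtCount 29 3 x)) = [[0, 2, 2], [1, 0, 3], [1, 3, 0]] := by
  decide +kernel

/-- `p = 41`: `SS^{w} = [0,2,4,5]` (`h(−164) = 8`), `F` fixes `0` and `2` (`41 ≡ 1 (8)`: `#(Cl[2] ∩ Cl²) = 2`). [folklore] -/
theorem alFixedReps_fortyOne :
    alFixedReps 41 = [0, 2, 4, 5] ∧ (alFixedReps 41).map (stabOrder 41) = [2, 1, 1, 1] ∧
      (alFixedReps 41).map (frobRep 41) = [0, 2, 5, 4] := by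
  decide +kernel

/-- `p = 59` (INERT, `h(−59) = 3`): three fixed classes, trivial stabilisers, `F` fixes exactly one, `T₃`-block symmetric =
Cayley graph of `ℤ/3` with `S = {l, l⁻¹}` mod 2. [folklore] -/
theorem alFixedReps_fiftyNine :
    alFixedReps 59 = [0, 5, 14] ∧ (alFixedReps 59).map (stabOrder 59) = [1, 1, 1] ∧
      (alFixedReps 59).map (frobRep 59) = [0, 14, 5] ∧
      (alFixedReps 59).map (fun x => (alFixedReps 59).map (fun y => brandtCount 59 3 x y % 2)) =
        [[0, 1, 1], [1, 0, 1], [1, 1, 0]] := by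
  decide +kernel

end Summit.BirchSwinnertonDyer.Rank1Residual.ManinAdditive.ALSupersingularCM
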